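import Summits.Ventures.PercRepro.Night2SeriesClassesThreeOneFS

/-!
# PercRepro — the explicit face-sum-budget cells of `(3, 1)` (night-2, gen 23)

`localShadowHall_three_one_five_eleven_of_twoPairsFS` (two disjoint fat pairs, `≤ 2` closures),
`…_fifteen_of_triangleFS` (a triangle, `≤ 3` closures), `…_sixteen_of_pairFS` / `…_seventeen_of_pairFS` (one fat pair,
one closure) — the generic cells of `Night2SeriesClassesThreeOneFS` with the classes `[2, 2]`, `[3]`, `[2]`.
-/

namespace PercRepro.Shadow

open Finset PerFlat ThmH

variable {α : Type*} [DecidableEq α] {M : Matroid α} [M.Finite]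

open scoped Classical in
/-- **The two-disjoint-pairs cell of `(3, 1)` at `|G| = 11` with `≤ 2` fat thin closures**: (LI_G) through the
face-sum budget with coloops and the class `[2, 2]`. -/
theorem localShadowHall_three_one_five_eleven_of_twoPairsFS {G : Finset α} (hG : G ∈ flatsQ M (5 + 1))
    (hd : (gr M \ G).card = 3) (hk : kColoops M G = 1)
    (hs : ∀ e ∈ gr M, ∀ f ∈ gr M, e ≠ f → rkN M {e, f} = 2) (hl : ∀ e ∈ gr M, M.Indep {e})
    (hn : G.card = 11) (hcl : (fatClosures M 5 G 2).card ≤ 2) {p x u v : α} (hpx : p ≠ x) (huv : u ≠ v)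
    (hdisj : Disjoint ({p, x} : Finset α) {u, v})
    (hK : ∀ a ∈ ({p, x, u, v} : Finset α), a ∉ coloops M G)
    (hH₀ : M.eRk ((G \ {p, x} : Finset α) : Set α) ≤ ((5 : ℕ) : ℕ∞))
    (hH₃ : M.eRk ((G \ {u, v} : Finset α) : Set α) ≤ ((5 : ℕ) : ℕ∞)) :
    LocalShadowHall M 5 G := by
  have hKe : ∀ {a b : α}, a ∉ coloops M G → b ∉ coloops M G → coloops M G ⊆ G \ {a, b} := by
    intro a b ha hb z hz
    rw [Finset.mem_sdiff]
    refine ⟨(mem_coloops.1 hz).1, ?_⟩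
    simp only [Finset.mem_insert, Finset.mem_singleton]
    rintro (rfl | rfl)
    · exact ha hz
    · exact hb hz
  have pairc : ∀ {a b : α}, M.eRk ((G \ {a, b} : Finset α) : Set α) ≤ ((5 : ℕ) : ℕ∞) →
      ∀ c ∈ ({a, b} : Finset α), ∀ e ∈ ({a, b} : Finset α), c ≠ e →
        M.eRk ((G \ {c, e} : Finset α) : Set α) ≤ ((5 : ℕ) : ℕ∞) := by
    intro a b h c hc e he hce
    simp only [Finset.mem_insert, Finset.mem_singleton] at hc he
    rcases hc with rfl | rfl <;> rcases he with rfl | rfl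
    · exact absurd rfl hce
    · exact h
    · rwa [Finset.pair_comm]
    · exact absurd rfl hce
  have hc₁ : ({p, x} : Finset α).card = 2 := Finset.card_pair hpx
  have hc₂ : ({u, v} : Finset α).card = 2 := Finset.card_pair huv
  have hKP : ∀ a ∈ ({p, x} : Finset α), a ∉ coloops M G := by
    intro a ha; apply hK; simp only [Finset.mem_insert, Finset.mem_singleton] at ha ⊢; tauto
  have hKQ : ∀ a ∈ ({u, v} : Finset α), a ∉ coloops M G := by
    intro a ha; apply hK; simp only [Finset.mem_insert, Finset.mem_singleton] at ha ⊢; tauto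
  refine localShadowHall_three_one_five_eleven_of_classesFS hG hd hk hs hl hn hcl [({p, x} : Finset α), {u, v}]
    ?_ ?_ ?_ ?_ ?_
  · rw [List.pairwise_cons]
    refine ⟨?_, List.pairwise_singleton _ _⟩
    intro C hC
    rw [List.mem_singleton] at hC
    rw [hC]; exact hdisj
  · intro C hC
    simp only [List.mem_cons, List.not_mem_nil, or_false] at hC
    rcases hC with rfl | rfl
    · rw [hc₁]; omega
    · rw [hc₂]; omega
  · intro C hC a ha b hb hab
    simp only [List.mem_cons, List.not_mem_nil, or_false] at hC
    rcases hC with rfl | rfl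
    · exact ⟨hKe (hKP a ha) (hKP b hb), pairc hH₀ a ha b hb hab⟩
    · exact ⟨hKe (hKQ a ha) (hKQ b hb), pairc hH₃ a ha b hb hab⟩
  · simp only [List.map_cons, List.map_nil, hc₁, hc₂]
    intro s h1 h2
    exact cntSeries_five_22_pos s h1 (by omega)
  · simp only [List.map_cons, List.map_nil, hc₁, hc₂]
    exact countSum_three_one_ten_22FS

open scoped Classical in
/-- **The triangle cell of `(3, 1)` at `|G| = 15` with `≤ 3` fat thin closures**: (LI_G) through the face-sum budget
with coloops and the class `[3]`. -/
theorem localShadowHall_three_one_five_fifteen_of_triangleFS {G : Finset α} (hG : G ∈ flatsQ M (5 + 1))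
    (hd : (gr M \ G).card = 3) (hk : kColoops M G = 1)
    (hs : ∀ e ∈ gr M, ∀ f ∈ gr M, e ≠ f → rkN M {e, f} = 2) (hl : ∀ e ∈ gr M, M.Indep {e})
    (hn : G.card = 15) (hcl : (fatClosures M 5 G 2).card ≤ 3) {p x y : α} (hpx : p ≠ x) (hpy : p ≠ y) (hxy : x ≠ y)
    (hK : ∀ a ∈ ({p, x, y} : Finset α), a ∉ coloops M G)
    (hH₀ : M.eRk ((G \ {p, x} : Finset α) : Set α) ≤ ((5 : ℕ) : ℕ∞))
    (hH₁ : M.eRk ((G \ {p, y} : Finset α) : Set α) ≤ ((5 : ℕ) : ℕ∞))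
    (hH₂ : M.eRk ((G \ {x, y} : Finset α) : Set α) ≤ ((5 : ℕ) : ℕ∞)) :
    LocalShadowHall M 5 G := by
  have hKe : ∀ {a b : α}, a ∉ coloops M G → b ∉ coloops M G → coloops M G ⊆ G \ {a, b} := by
    intro a b ha hb z hz
    rw [Finset.mem_sdiff]
    refine ⟨(mem_coloops.1 hz).1, ?_⟩
    simp only [Finset.mem_insert, Finset.mem_singleton]
    rintro (rfl | rfl)
    · exact ha hz
    · exact hb hz
  have pairc : ∀ {a b : α}, M.eRk ((G \ {a, b} : Finset α) : Set α) ≤ ((5 : ℕ) : ℕ∞) →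
      ∀ c ∈ ({a, b} : Finset α), ∀ e ∈ ({a, b} : Finset α), c ≠ e →
        M.eRk ((G \ {c, e} : Finset α) : Set α) ≤ ((5 : ℕ) : ℕ∞) := by
    intro a b h c hc e he hce
    simp only [Finset.mem_insert, Finset.mem_singleton] at hc he
    rcases hc with rfl | rfl <;> rcases he with rfl | rfl
    · exact absurd rfl hce
    · exact h
    · rwa [Finset.pair_comm]
    · exact absurd rfl hce
  have hc3 : ({p, x, y} : Finset α).card = 3 := by
    rw [Finset.card_insert_of_notMem (by simp [hpx, hpy]), Finset.card_pair hxy]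
  refine localShadowHall_three_one_five_fifteen_of_classesFS hG hd hk hs hl hn hcl [({p, x, y} : Finset α)]
    (List.pairwise_singleton _ _) ?_ ?_ ?_ ?_
  · intro C hC
    rw [List.mem_singleton] at hC
    rw [hC, hc3]; omega
  · intro C hC a ha b hb hab
    rw [List.mem_singleton] at hC
    rw [hC] at ha hb
    exact ⟨hKe (hK a ha) (hK b hb), triangle_cocircuits hH₀ hH₁ hH₂ a ha b hb hab⟩
  · simp only [List.map_cons, List.map_nil, hc3]
    intro s h1 h2
    exact cntSeries_five_3_pos s h1 (by omega)
  · simp only [List.map_cons, List.map_nil, hc3]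
    exact countSum_three_one_fourteen_3FS

open scoped Classical in
/-- **The single-fat-pair cell of `(3, 1)` at `|G| = 16`** (one fat thin closure): (LI_G) through the face-sum budget
with coloops and the class `[2]`. -/
theorem localShadowHall_three_one_five_sixteen_of_pairFS {G : Finset α} (hG : G ∈ flatsQ M (5 + 1))
    (hd : (gr M \ G).card = 3) (hk : kColoops M G = 1)
    (hs : ∀ e ∈ gr M, ∀ f ∈ gr M, e ≠ f → rkN M {e, f} = 2) (hl : ∀ e ∈ gr M, M.Indep {e})
    (hn : G.card = 16) (hcl : (fatClosures M 5 G 2).card ≤ 1) {p x : α} (hpx : p ≠ x)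
    (hK : ∀ a ∈ ({p, x} : Finset α), a ∉ coloops M G)
    (hH₀ : M.eRk ((G \ {p, x} : Finset α) : Set α) ≤ ((5 : ℕ) : ℕ∞)) :
    LocalShadowHall M 5 G := by
  have hKe : ∀ {a b : α}, a ∉ coloops M G → b ∉ coloops M G → coloops M G ⊆ G \ {a, b} := by
    intro a b ha hb z hz
    rw [Finset.mem_sdiff]
    refine ⟨(mem_coloops.1 hz).1, ?_⟩
    simp only [Finset.mem_insert, Finset.mem_singleton]
    rintro (rfl | rfl)
    · exact ha hz
    · exact hb hz
  have pairc : ∀ {a b : α}, M.eRk ((G \ {a, b} : Finset α) : Set α) ≤ ((5 : ℕ) : ℕ∞) →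
      ∀ c ∈ ({a, b} : Finset α), ∀ e ∈ ({a, b} : Finset α), c ≠ e →
        M.eRk ((G \ {c, e} : Finset α) : Set α) ≤ ((5 : ℕ) : ℕ∞) := by
    intro a b h c hc e he hce
    simp only [Finset.mem_insert, Finset.mem_singleton] at hc he
    rcases hc with rfl | rfl <;> rcases he with rfl | rfl
    · exact absurd rfl hce
    · exact h
    · rwa [Finset.pair_comm]
    · exact absurd rfl hce
  have hc₁ : ({p, x} : Finset α).card = 2 := Finset.card_pair hpx
  refine localShadowHall_three_one_five_sixteen_of_classesFS hG hd hk hs hl hn hcl [({p, x} : Finset α)]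
    (List.pairwise_singleton _ _) ?_ ?_ ?_ ?_
  · intro C hC
    rw [List.mem_singleton] at hC
    rw [hC, hc₁]; omega
  · intro C hC a ha b hb hab
    rw [List.mem_singleton] at hC
    rw [hC] at ha hb
    exact ⟨hKe (hK a ha) (hK b hb), pairc hH₀ a ha b hb hab⟩
  · simp only [List.map_cons, List.map_nil, hc₁]
    intro s h1 h2
    exact cntSeries_five_2_pos s h1 (by omega)
  · simp only [List.map_cons, List.map_nil, hc₁]
    exact countSum_three_one_fifteen_2FS

open scoped Classical in
/-- **The single-fat-pair cell of `(3, 1)` at `|G| = 17`** (one fat thin closure): (LI_G) through the face-sum budget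
with coloops and the class `[2]`. -/
theorem localShadowHall_three_one_five_seventeen_of_pairFS {G : Finset α} (hG : G ∈ flatsQ M (5 + 1))
    (hd : (gr M \ G).card = 3) (hk : kColoops M G = 1)
    (hs : ∀ e ∈ gr M, ∀ f ∈ gr M, e ≠ f → rkN M {e, f} = 2) (hl : ∀ e ∈ gr M, M.Indep {e})
    (hn : G.card = 17) (hcl : (fatClosures M 5 G 2).card ≤ 1) {p x : α} (hpx : p ≠ x)
    (hK : ∀ a ∈ ({p, x} : Finset α), a ∉ coloops M G)
    (hH₀ : M.eRk ((G \ {p, x} : Finset α) : Set α) ≤ ((5 : ℕ) : ℕ∞)) :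
    LocalShadowHall M 5 G := by
  have hKe : ∀ {a b : α}, a ∉ coloops M G → b ∉ coloops M G → coloops M G ⊆ G \ {a, b} := by
    intro a b ha hb z hz
    rw [Finset.mem_sdiff]
    refine ⟨(mem_coloops.1 hz).1, ?_⟩
    simp only [Finset.mem_insert, Finset.mem_singleton]
    rintro (rfl | rfl)
    · exact ha hz
    · exact hb hz
  have pairc : ∀ {a b : α}, M.eRk ((G \ {a, b} : Finset α) : Set α) ≤ ((5 : ℕ) : ℕ∞) →
      ∀ c ∈ ({a, b} : Finset α), ∀ e ∈ ({a, b} : Finset α), c ≠ e →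
        M.eRk ((G \ {c, e} : Finset α) : Set α) ≤ ((5 : ℕ) : ℕ∞) := by
    intro a b h c hc e he hce
    simp only [Finset.mem_insert, Finset.mem_singleton] at hc he
    rcases hc with rfl | rfl <;> rcases he with rfl | rfl
    · exact absurd rfl hce
    · exact h
    · rwa [Finset.pair_comm]
    · exact absurd rfl hce
  have hc₁ : ({p, x} : Finset α).card = 2 := Finset.card_pair hpx
  refine localShadowHall_three_one_five_seventeen_of_classesFS hG hd hk hs hl hn hcl [({p, x} : Finset α)]
    (List.pairwise_singleton _ _) ?_ ?_ ?_ ?_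
  · intro C hC
    rw [List.mem_singleton] at hC
    rw [hC, hc₁]; omega
  · intro C hC a ha b hb hab
    rw [List.mem_singleton] at hC
    rw [hC] at ha hb
    exact ⟨hKe (hK a ha) (hK b hb), pairc hH₀ a ha b hb hab⟩
  · simp only [List.map_cons, List.map_nil, hc₁]
    intro s h1 h2
    exact cntSeries_five_2_pos s h1 (by omega)
  · simp only [List.map_cons, List.map_nil, hc₁]
    exact countSum_three_one_sixteen_2FS

end PercRepro.Shadow
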